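import Summits.QuantumFields.YangMills.Theorems.BalabanUVNodesN15TwoGridL2Transfer
import HarnessLib

/-!
# Route «BalabanUVNodes», node N15 = NE2, -a lane, part 65: ENTRY 2 `𝔇(G∇*) = G′∇′*P − PG∇*` OF [B9] (3.42) — THE ADJOINT OPERATOR `S = T2† = R∇′G′ − ∇GR`, THE EXACT
# TWO-GRID INTERTWININGS OF KING's BLOCK AVERAGE (`∇R = RA∇′`, `∇*R = RĀ∇′*`), THE RESOLVENT IDENTITY, AND THE FIVE-PIECE SPLIT OF `S` (entry 2, fifth file)

Cell `pub-ymgap`, seat `pub-ymgap-dag-n15-a` (KNIT-BY-NAME, g13); `--kind proof --supports stmt-QuantumFields-20507 --as helper`.  Over parts 63∕64 (`wdot`∕`LinearMap.IsAdjointPair`, `ravg`, `isAdj_pull_ravg`, `isAdjW_unique`),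
part 34 (`symbOp_sD_sA_comp_pull`), part 35 (`symbOp_sTinv_pow_comp_pull`), part 39 (`gOp_comp_deltaOp`, `deltaOp_comp_gOp`), part 46 (`deltaOp_eq`), `T4EtaRateDefect.idef_inv`.
THE ARGUMENT (entry 2 has its derivative on the ROUGH coarse source — no sup-only route; this seat's route: duality + L²).  `T2_μ := idef P P (G′∘∇′*_μ) (G∘∇*_μ)`; its weighted adjoint
(`η^{d+1}`, `η′^{d+1}`) is `S_μ = R∘∇′_μ∘G′ − ∇_μ∘G∘R` (§93 `isAdj_entry2`), an entry-1-type operator with King's block AVERAGE `R` as transport, for which the tree's (1.114) L² entries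
(part 62) control the consistency defects.  EXACT IDENTITIES (§92): the backward intertwining `ρ′(n′(s⁻¹−1))∘ρ′(ā_ν)∘P = P∘ρ(n(s⁻¹−1))` (`symbOp_sDbar_sAbar_comp_pull`, twin of part 34's);
by adjoint UNIQUENESS `∇_μ∘R = R∘A_μ∘∇′_μ` (`sD_comp_ravg`) and `∇*_ν∘R = R∘Ā_ν∘∇′*_ν` (`sDbar_comp_ravg`); the resolvent identity `RG′ − GR = G(Δ_aR − RΔ′_a)G′` (`ravg_resolvent`).
THE SPLIT (§94): with `Δ_a = ρ(sLap) − V + aQ*Q` (part 46) and `sLapDir = (n(s⁻¹−1))(n(s−1))` (part 63),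
  `S = S₁ + S₂ + S₃ + S₄ + S₅`,  `S₁ = R(1−A_μ)∇′_μG′`, `S₂ = Σ_ν ∇_μG∇*_ν·R(A_ν−1)·∇′_νG′`, `S₃ = −Σ_ν ∇_μG·R(1−Ā_ν)∇′*_ν∇′_ν·G′`, `S₄ = −∇_μG(VR − RV′)G′`,
  `S₅ = ∇_μG(a·Q*QR − R·a·Q′*Q′)G′` (★★ `entry2_adjoint_split`) — `S₁`, `S₂` are bounded in L² by (1.114) (`∇∇G`, `∇G∇*`) with the gain `η` of `(1−A)∇′` (part 64); `S₃`, `S₄`, `S₅` are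
  bounded through their ADJOINTS in the tree's sup currency (sequel): `S₃† = −Σ_ν G′∇′*_ν∇′_ν(1−A_ν)P(G∇*_μ)` ((1.114) `G∇*∇*` on a sup-small source), `S₄† = G′(V′P − PV)(G∇*_μ)` (part 53),
  `S₅† = −aG′[Q′*(Q′P − Q) + (Q′* − PQ*)Q](G∇*_μ)` (part 45).
HONEST FRAMING ∕ LIMITS.  Finite lattice algebra ([folklore]); NO estimate here; count-neutral (typed 28∕28 · discharged 5∕27 of record unchanged); NOT a discharge of N15 (object-bound; NE2⁺ NOT
PRINTED); one finite T⁴ at fixed ε — NOT infinite volume, NOT OS on ℝ⁴, NOT a mass gap, NOT Clay.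
-/

noncomputable section

open scoped BigOperators
open Finset

namespace Summit.QuantumFields.YangMills.BalabanUVNodes.N15.TwoGrid

open Literature.MathematicalPhysics.QuantumFieldTheory.Balaban1983to89
open Literature.MathematicalPhysics.QuantumFieldTheory.Balaban1983to89.T4EtaRateDefect (idef idef_inv)
open Literature.MathematicalPhysics.QuantumFieldTheory.Balaban1983to89.T4EtaRateCoeffDefect (pull pull_apply)
open Literature.MathematicalPhysics.QuantumFieldTheory.Balaban1983to89.B5Prop11Plancherel (Tor fine unitVec)
open Literature.MathematicalPhysics.QuantumFieldTheory.Balaban1983to89.B5SettingP12Weighted (etaPow etaPow_nonneg)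
open Summit.QuantumFields.YangMills.BalabanUVNodes.N15.VectorPiece (kingPr kingPrV kingPrV_eq)

variable {d : ℕ} {L : ℕ} [NeZero L] (M : Fin (d + 1) → ℕ) [∀ μ, NeZero (M μ)] (k m : ℕ) (a : ℝ)

/-! ## §92 The exact two-grid intertwinings of King's block average -/

/-- **THE BACKWARD INTERTWINING** (twin of part 34 `symbOp_sD_sA_comp_pull`): `ρ′(n′(s_ν⁻¹ − 1))∘ρ′(ā_ν)∘P = P∘ρ(n(s_ν⁻¹ − 1))` with the BACKWARD box filter
`ā_ν = L^{−m}Σ_{j<L^m} s_ν^{−j}`: `n′(s⁻¹−1)ā = n(s^{−L^m} − 1)` and part 35's `symbOp_sTinv_pow_comp_pull`. [folklore] -/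
theorem symbOp_sDbar_sAbar_comp_pull (ν : Fin (d + 1)) :
    symbOp M (L ^ m * L ^ k) (((L ^ m * L ^ k : ℕ) : ℝ) • (sTinv M (L ^ m * L ^ k) ν - 1)) ∘ₗ
        (symbOp M (L ^ m * L ^ k) (((L ^ m : ℕ) : ℝ)⁻¹ • ∑ j ∈ range (L ^ m), sTinv M (L ^ m * L ^ k) ν ^ j) ∘ₗ pull (kingPrV L k m M)) =
      pull (kingPrV L k m M) ∘ₗ symbOp M (L ^ k) (((L ^ k : ℕ) : ℝ) • (sTinv M (L ^ k) ν - 1)) := by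
  have hLm : ((L ^ m : ℕ) : ℝ) ≠ 0 := by exact_mod_cast pow_ne_zero m (NeZero.ne L)
  have hsym : (((L ^ m * L ^ k : ℕ) : ℝ) • (sTinv M (L ^ m * L ^ k) ν - 1)) * (((L ^ m : ℕ) : ℝ)⁻¹ • ∑ j ∈ range (L ^ m), sTinv M (L ^ m * L ^ k) ν ^ j)
      = ((L ^ k : ℕ) : ℝ) • (sTinv M (L ^ m * L ^ k) ν ^ L ^ m - 1) := by
    rw [smul_mul_smul_comm, mul_geom_sum]
    congr 1
    have hL : (L : ℝ) ≠ 0 := Nat.cast_ne_zero.mpr (NeZero.ne L)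
    push_cast
    rw [mul_comm, ← mul_assoc, inv_mul_cancel₀ (pow_ne_zero _ hL), one_mul]
  rw [← LinearMap.comp_assoc, ← Module.End.mul_eq_comp, ← map_mul, hsym, map_smul, map_sub, map_one, LinearMap.smul_comp, LinearMap.sub_comp, Module.End.one_eq_id,
    LinearMap.id_comp, symbOp_sTinv_pow_comp_pull, map_smul, map_sub, map_one, LinearMap.comp_smul, LinearMap.comp_sub, Module.End.one_eq_id, LinearMap.comp_id]

/-- ★ **`∇_μ∘R = R∘A_μ∘∇′_μ`** (King's block average intertwines the COARSE forward difference with the box-filtered FINE one): both sides are the weighted adjoint of `P∘∇*_μ =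
∇′*_μĀ_μP` — adjoint uniqueness (part 63). [folklore] -/
theorem sD_comp_ravg (ν : Fin (d + 1)) :
    symbOp M (L ^ k) (sD M (L ^ k) ν ((L ^ k : ℕ) : ℝ)) ∘ₗ ravg M L k m =
      ravg M L k m ∘ₗ symbOp M (L ^ m * L ^ k) (sA M (L ^ m * L ^ k) ν (L ^ m)) ∘ₗ symbOp M (L ^ m * L ^ k) (sD M (L ^ m * L ^ k) ν ((L ^ m * L ^ k : ℕ) : ℝ)) := by
  have hw : etaPow (L ^ k) (d + 1) ≠ 0 := by
    unfold etaPow; exact pow_ne_zero _ (inv_ne_zero (by exact_mod_cast pow_ne_zero k (NeZero.ne L)))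
  -- the adjoint of `P∘∇*_μ` computed in two ways
  have h1 : LinearMap.IsAdjointPair (wdot (etaPow (L ^ k) (d + 1))) (wdot (etaPow (L ^ m * L ^ k) (d + 1))) (pull (kingPrV L k m M) ∘ₗ symbOp M (L ^ k) (((L ^ k : ℕ) : ℝ) • (sTinv M (L ^ k) ν - 1)))
      (symbOp M (L ^ k) (sD M (L ^ k) ν ((L ^ k : ℕ) : ℝ)) ∘ₗ ravg M L k m) :=
    isAdjW_comp (isAdj_pull_ravg M L k m) (isAdj_sDbar M (L ^ k) ν ((L ^ k : ℕ) : ℝ))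
  have hA : LinearMap.IsAdjointPair (wdot (etaPow (L ^ m * L ^ k) (d + 1))) (wdot (etaPow (L ^ m * L ^ k) (d + 1)))
      (symbOp M (L ^ m * L ^ k) (((L ^ m : ℕ) : ℝ)⁻¹ • ∑ j ∈ range (L ^ m), sTinv M (L ^ m * L ^ k) ν ^ j)) (symbOp M (L ^ m * L ^ k) (sA M (L ^ m * L ^ k) ν (L ^ m))) := by
    rw [sA, Nat.cast_pow]
    refine isAdj_symbOp_smul M _ ?_ _
    rw [map_sum, map_sum]
    exact isAdjW_sum (range (L ^ m)) fun j _ => isAdj_sTinv_pow M _ ν j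
  have h2 : LinearMap.IsAdjointPair (wdot (etaPow (L ^ k) (d + 1))) (wdot (etaPow (L ^ m * L ^ k) (d + 1)))
      ((symbOp M (L ^ m * L ^ k) (((L ^ m * L ^ k : ℕ) : ℝ) • (sTinv M (L ^ m * L ^ k) ν - 1)) ∘ₗ
          symbOp M (L ^ m * L ^ k) (((L ^ m : ℕ) : ℝ)⁻¹ • ∑ j ∈ range (L ^ m), sTinv M (L ^ m * L ^ k) ν ^ j)) ∘ₗ pull (kingPrV L k m M))
      (ravg M L k m ∘ₗ symbOp M (L ^ m * L ^ k) (sA M (L ^ m * L ^ k) ν (L ^ m)) ∘ₗ symbOp M (L ^ m * L ^ k) (sD M (L ^ m * L ^ k) ν ((L ^ m * L ^ k : ℕ) : ℝ))) :=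
    isAdjW_comp (isAdjW_comp (isAdj_sDbar M (L ^ m * L ^ k) ν ((L ^ m * L ^ k : ℕ) : ℝ)) hA) (isAdj_pull_ravg M L k m)
  rw [LinearMap.comp_assoc, symbOp_sDbar_sAbar_comp_pull M k m ν] at h2
  exact isAdjW_unique hw h1 h2

/-- ★ **`∇*_ν∘R = R∘Ā_ν∘∇′*_ν`**: both sides are the weighted adjoint of `P∘∇_ν = ∇′_νA_νP` (part 34 `symbOp_sD_sA_comp_pull`). [folklore] -/
theorem sDbar_comp_ravg (ν : Fin (d + 1)) :
    symbOp M (L ^ k) (((L ^ k : ℕ) : ℝ) • (sTinv M (L ^ k) ν - 1)) ∘ₗ ravg M L k m =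
      ravg M L k m ∘ₗ symbOp M (L ^ m * L ^ k) (((L ^ m : ℕ) : ℝ)⁻¹ • ∑ j ∈ range (L ^ m), sTinv M (L ^ m * L ^ k) ν ^ j) ∘ₗ
        symbOp M (L ^ m * L ^ k) (((L ^ m * L ^ k : ℕ) : ℝ) • (sTinv M (L ^ m * L ^ k) ν - 1)) := by
  have hw : etaPow (L ^ k) (d + 1) ≠ 0 := by
    unfold etaPow; exact pow_ne_zero _ (inv_ne_zero (by exact_mod_cast pow_ne_zero k (NeZero.ne L)))
  have hcast : ((L ^ k : ℕ) : ℝ) * (L : ℝ) ^ m = ((L ^ m * L ^ k : ℕ) : ℝ) := by push_cast; ring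
  have hfwd := symbOp_sD_sA_comp_pull M L k m ν ((L ^ k : ℕ) : ℝ)
  rw [hcast] at hfwd
  have h1 : LinearMap.IsAdjointPair (wdot (etaPow (L ^ k) (d + 1))) (wdot (etaPow (L ^ m * L ^ k) (d + 1))) (pull (kingPrV L k m M) ∘ₗ symbOp M (L ^ k) (sD M (L ^ k) ν ((L ^ k : ℕ) : ℝ)))
      (symbOp M (L ^ k) (((L ^ k : ℕ) : ℝ) • (sTinv M (L ^ k) ν - 1)) ∘ₗ ravg M L k m) :=
    isAdjW_comp (isAdj_pull_ravg M L k m) (isAdj_sD M (L ^ k) ν ((L ^ k : ℕ) : ℝ))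
  have hA : LinearMap.IsAdjointPair (wdot (etaPow (L ^ m * L ^ k) (d + 1))) (wdot (etaPow (L ^ m * L ^ k) (d + 1)))
      (symbOp M (L ^ m * L ^ k) (sA M (L ^ m * L ^ k) ν (L ^ m))) (symbOp M (L ^ m * L ^ k) (((L ^ m : ℕ) : ℝ)⁻¹ • ∑ j ∈ range (L ^ m), sTinv M (L ^ m * L ^ k) ν ^ j)) := by
    rw [sA, Nat.cast_pow]
    refine isAdj_symbOp_smul M _ ?_ _
    rw [map_sum, map_sum]
    exact isAdjW_sum (range (L ^ m)) fun j _ => isAdj_sT_pow M _ ν j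
  have h2 : LinearMap.IsAdjointPair (wdot (etaPow (L ^ k) (d + 1))) (wdot (etaPow (L ^ m * L ^ k) (d + 1)))
      ((symbOp M (L ^ m * L ^ k) (sD M (L ^ m * L ^ k) ν ((L ^ m * L ^ k : ℕ) : ℝ)) ∘ₗ symbOp M (L ^ m * L ^ k) (sA M (L ^ m * L ^ k) ν (L ^ m))) ∘ₗ pull (kingPrV L k m M))
      (ravg M L k m ∘ₗ symbOp M (L ^ m * L ^ k) (((L ^ m : ℕ) : ℝ)⁻¹ • ∑ j ∈ range (L ^ m), sTinv M (L ^ m * L ^ k) ν ^ j) ∘ₗ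
        symbOp M (L ^ m * L ^ k) (((L ^ m * L ^ k : ℕ) : ℝ) • (sTinv M (L ^ m * L ^ k) ν - 1))) :=
    isAdjW_comp (isAdjW_comp (isAdj_sD M (L ^ m * L ^ k) ν ((L ^ m * L ^ k : ℕ) : ℝ)) hA) (isAdj_pull_ravg M L k m)
  rw [LinearMap.comp_assoc, hfwd] at h2
  exact isAdjW_unique hw h1 h2

/-- ★ **THE RESOLVENT IDENTITY FOR THE BLOCK AVERAGE**: `R∘G′ − G∘R = G∘(Δ_a∘R − R∘Δ′_a)∘G′` (`idef_inv` with both transports `R`: `GΔ_a = 1` on the coarse lattice, `Δ′_aG′ = 1` on the fine one).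
[cite: Balaban1984PropagatorsI, (1.71) p.30 (G = Δ_a⁻¹)] -/
theorem ravg_resolvent (ha : 0 < a) :
    ravg M L k m ∘ₗ gOp M (L ^ m * L ^ k) a - gOp M (L ^ k) a ∘ₗ ravg M L k m =
      gOp M (L ^ k) a ∘ₗ (deltaOp M (L ^ k) a ∘ₗ ravg M L k m - ravg M L k m ∘ₗ deltaOp M (L ^ m * L ^ k) a) ∘ₗ gOp M (L ^ m * L ^ k) a := by
  have hL0 : 0 < L := Nat.pos_of_ne_zero (NeZero.ne L)
  have hn1 : 1 ≤ L ^ k := Nat.one_le_pow _ _ hL0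
  have hn'1 : 1 ≤ L ^ m * L ^ k := Nat.one_le_iff_ne_zero.mpr (Nat.mul_ne_zero (pow_ne_zero m (NeZero.ne L)) (pow_ne_zero k (NeZero.ne L)))
  have hG := gOp_comp_deltaOp M (L ^ k) a hn1 ha
  have hG' := deltaOp_comp_gOp M (L ^ m * L ^ k) a hn'1 ha
  symm
  calc gOp M (L ^ k) a ∘ₗ (deltaOp M (L ^ k) a ∘ₗ ravg M L k m - ravg M L k m ∘ₗ deltaOp M (L ^ m * L ^ k) a) ∘ₗ gOp M (L ^ m * L ^ k) a
      = (gOp M (L ^ k) a ∘ₗ deltaOp M (L ^ k) a) ∘ₗ (ravg M L k m ∘ₗ gOp M (L ^ m * L ^ k) a)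
          - gOp M (L ^ k) a ∘ₗ (ravg M L k m ∘ₗ (deltaOp M (L ^ m * L ^ k) a ∘ₗ gOp M (L ^ m * L ^ k) a)) := by
        simp only [LinearMap.comp_sub, LinearMap.sub_comp, LinearMap.comp_assoc]
    _ = _ := by rw [hG, hG', LinearMap.id_comp, LinearMap.comp_id]

/-! ## §93 The adjoint pair `(T2, S)` -/

/-- ★ **`S_μ = R∘∇′_μ∘G′ − ∇_μ∘G∘R` IS THE WEIGHTED ADJOINT OF THE ENTRY-2 OPERATOR `T2_μ = idef P P (G′∘∇′*_μ) (G∘∇*_μ)`** (weights `η^{d+1}` coarse, `η′^{d+1}` fine): `P† = R`, `G† = G`,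
`(∇*)† = ∇`. [cite: Balaban1984PropagatorsI, Prop. 1.1 p.33 («G is a symmetric operator»)] -/
theorem isAdj_entry2 (ha : 0 < a) (μ : Fin (d + 1)) :
    LinearMap.IsAdjointPair (wdot (etaPow (L ^ k) (d + 1))) (wdot (etaPow (L ^ m * L ^ k) (d + 1)))
      (idef (pull (kingPrV L k m M)) (pull (kingPrV L k m M))
        (gOp M (L ^ m * L ^ k) a ∘ₗ symbOp M (L ^ m * L ^ k) (((L ^ m * L ^ k : ℕ) : ℝ) • (sTinv M (L ^ m * L ^ k) μ - 1)))
        (gOp M (L ^ k) a ∘ₗ symbOp M (L ^ k) (((L ^ k : ℕ) : ℝ) • (sTinv M (L ^ k) μ - 1))))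
      ⇑(ravg M L k m ∘ₗ (symbOp M (L ^ m * L ^ k) (sD M (L ^ m * L ^ k) μ ((L ^ m * L ^ k : ℕ) : ℝ)) ∘ₗ gOp M (L ^ m * L ^ k) a)
        - (symbOp M (L ^ k) (sD M (L ^ k) μ ((L ^ k : ℕ) : ℝ)) ∘ₗ gOp M (L ^ k) a) ∘ₗ ravg M L k m) := by
  have hL0 : 0 < L := Nat.pos_of_ne_zero (NeZero.ne L)
  have hn1 : 1 ≤ L ^ k := Nat.one_le_pow _ _ hL0
  have hn'1 : 1 ≤ L ^ m * L ^ k := Nat.one_le_iff_ne_zero.mpr (Nat.mul_ne_zero (pow_ne_zero m (NeZero.ne L)) (pow_ne_zero k (NeZero.ne L)))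
  rw [idef]
  refine isAdjW_sub ?_ ?_
  · exact isAdjW_comp (isAdjW_comp (isAdj_gOp M (L ^ m * L ^ k) a hn'1 ha) (isAdj_sDbar M _ μ _)) (isAdj_pull_ravg M L k m)
  · exact isAdjW_comp (isAdj_pull_ravg M L k m) (isAdjW_comp (isAdj_gOp M (L ^ k) a hn1 ha) (isAdj_sDbar M _ μ _))

/-! ## §94 ★★ The five-piece split of `S` -/

/-- **STEP 1**: `S = R(1 − A_μ)∇′_μG′ + ∇_μG(Δ_aR − RΔ′_a)G′` (`∇_μR = RA_μ∇′_μ` and the resolvent identity). [folklore] -/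
theorem entry2_adjoint_step1 (ha : 0 < a) (μ : Fin (d + 1)) :
    ravg M L k m ∘ₗ (symbOp M (L ^ m * L ^ k) (sD M (L ^ m * L ^ k) μ ((L ^ m * L ^ k : ℕ) : ℝ)) ∘ₗ gOp M (L ^ m * L ^ k) a)
        - (symbOp M (L ^ k) (sD M (L ^ k) μ ((L ^ k : ℕ) : ℝ)) ∘ₗ gOp M (L ^ k) a) ∘ₗ ravg M L k m
      = ravg M L k m ∘ₗ symbOp M (L ^ m * L ^ k) (1 - sA M (L ^ m * L ^ k) μ (L ^ m)) ∘ₗ symbOp M (L ^ m * L ^ k) (sD M (L ^ m * L ^ k) μ ((L ^ m * L ^ k : ℕ) : ℝ)) ∘ₗ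
          gOp M (L ^ m * L ^ k) a
        + symbOp M (L ^ k) (sD M (L ^ k) μ ((L ^ k : ℕ) : ℝ)) ∘ₗ gOp M (L ^ k) a ∘ₗ
          (deltaOp M (L ^ k) a ∘ₗ ravg M L k m - ravg M L k m ∘ₗ deltaOp M (L ^ m * L ^ k) a) ∘ₗ gOp M (L ^ m * L ^ k) a := by
  have hres := ravg_resolvent (L := L) M k m a ha
  have hI1 := sD_comp_ravg (L := L) M k m μ
  refine LinearMap.ext fun f => ?_
  simp only [LinearMap.sub_apply, LinearMap.add_apply, LinearMap.comp_apply]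
  -- pointwise: `G(Rf) = R(G′f) − G(Δ_aR G′f − RΔ′_a G′f)`, `∇(R X) = R(A∇′X)`, `ρ′(1 − a) Y = Y − ρ′(a)Y`
  have hGRf : gOp M (L ^ k) a (ravg M L k m f) = ravg M L k m (gOp M (L ^ m * L ^ k) a f)
      - gOp M (L ^ k) a (deltaOp M (L ^ k) a (ravg M L k m (gOp M (L ^ m * L ^ k) a f)) - ravg M L k m (deltaOp M (L ^ m * L ^ k) a (gOp M (L ^ m * L ^ k) a f))) := by
    have h := LinearMap.congr_fun hres f
    simp only [LinearMap.sub_apply, LinearMap.comp_apply] at h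
    rw [← h]
    abel
  have hI1f : symbOp M (L ^ k) (sD M (L ^ k) μ ((L ^ k : ℕ) : ℝ)) (ravg M L k m (gOp M (L ^ m * L ^ k) a f))
      = ravg M L k m (symbOp M (L ^ m * L ^ k) (sA M (L ^ m * L ^ k) μ (L ^ m)) (symbOp M (L ^ m * L ^ k) (sD M (L ^ m * L ^ k) μ ((L ^ m * L ^ k : ℕ) : ℝ)) (gOp M (L ^ m * L ^ k) a f))) := by
    have h := LinearMap.congr_fun hI1 (gOp M (L ^ m * L ^ k) a f)
    simp only [LinearMap.comp_apply] at h
    exact h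
  rw [hGRf, map_sub (symbOp M (L ^ k) (sD M (L ^ k) μ ((L ^ k : ℕ) : ℝ))), hI1f, map_sub (symbOp M (L ^ m * L ^ k)), map_one, LinearMap.sub_apply,
    Module.End.one_apply, map_sub (ravg M L k m)]
  abel

/-- **THE LAPLACIAN CONSISTENCY OF THE BLOCK AVERAGE**: `ρ(sLap)∘R − R∘ρ′(sLap′) = Σ_ν ∇*_ν∘R∘(A_ν − 1)∘∇′_ν − Σ_ν R∘(1 − Ā_ν)∘∇′*_ν∘∇′_ν` (`sLapDir = ∇*∇`, §92). [folklore] -/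
theorem sLap_comp_ravg_sub :
    symbOp M (L ^ k) (sLap M (L ^ k) ((L ^ k : ℕ) : ℝ)) ∘ₗ ravg M L k m - ravg M L k m ∘ₗ symbOp M (L ^ m * L ^ k) (sLap M (L ^ m * L ^ k) ((L ^ m * L ^ k : ℕ) : ℝ))
      = ∑ ν : Fin (d + 1), symbOp M (L ^ k) (((L ^ k : ℕ) : ℝ) • (sTinv M (L ^ k) ν - 1)) ∘ₗ ravg M L k m ∘ₗ
            symbOp M (L ^ m * L ^ k) (sA M (L ^ m * L ^ k) ν (L ^ m) - 1) ∘ₗ symbOp M (L ^ m * L ^ k) (sD M (L ^ m * L ^ k) ν ((L ^ m * L ^ k : ℕ) : ℝ))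
        - ∑ ν : Fin (d + 1), ravg M L k m ∘ₗ symbOp M (L ^ m * L ^ k) (1 - ((L ^ m : ℕ) : ℝ)⁻¹ • ∑ j ∈ range (L ^ m), sTinv M (L ^ m * L ^ k) ν ^ j) ∘ₗ
            symbOp M (L ^ m * L ^ k) (((L ^ m * L ^ k : ℕ) : ℝ) • (sTinv M (L ^ m * L ^ k) ν - 1)) ∘ₗ symbOp M (L ^ m * L ^ k) (sD M (L ^ m * L ^ k) ν ((L ^ m * L ^ k : ℕ) : ℝ)) := by
  rw [sLap, sLap, map_sum, map_sum]
  refine LinearMap.ext fun f => ?_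
  simp only [LinearMap.sub_apply, LinearMap.sum_apply, LinearMap.comp_apply, map_sum, ← Finset.sum_sub_distrib]
  refine sum_congr rfl fun ν _ => ?_
  have hI1f : ∀ g, symbOp M (L ^ k) (sD M (L ^ k) ν ((L ^ k : ℕ) : ℝ)) (ravg M L k m g)
      = ravg M L k m (symbOp M (L ^ m * L ^ k) (sA M (L ^ m * L ^ k) ν (L ^ m)) (symbOp M (L ^ m * L ^ k) (sD M (L ^ m * L ^ k) ν ((L ^ m * L ^ k : ℕ) : ℝ)) g)) := fun g => by
    have h := LinearMap.congr_fun (sD_comp_ravg (L := L) M k m ν) g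
    simp only [LinearMap.comp_apply] at h
    exact h
  have hI2f : ∀ g, symbOp M (L ^ k) (((L ^ k : ℕ) : ℝ) • (sTinv M (L ^ k) ν - 1)) (ravg M L k m g)
      = ravg M L k m (symbOp M (L ^ m * L ^ k) (((L ^ m : ℕ) : ℝ)⁻¹ • ∑ j ∈ range (L ^ m), sTinv M (L ^ m * L ^ k) ν ^ j)
          (symbOp M (L ^ m * L ^ k) (((L ^ m * L ^ k : ℕ) : ℝ) • (sTinv M (L ^ m * L ^ k) ν - 1)) g)) := fun g => by
    have h := LinearMap.congr_fun (sDbar_comp_ravg (L := L) M k m ν) g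
    simp only [LinearMap.comp_apply] at h
    exact h
  rw [sLapDir_eq_sDbar_mul_sD, sLapDir_eq_sDbar_mul_sD]
  simp only [map_mul, map_sub, map_one, Module.End.mul_apply, LinearMap.sub_apply, Module.End.one_apply]
  rw [hI1f f, ← hI2f]
  abel

end Summit.QuantumFields.YangMills.BalabanUVNodes.N15.TwoGrid
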